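import Summits.QuantumFields.BalabanUV.Gaps.CapBlockTransferFloors
import Summits.QuantumFields.BalabanUV.Gaps.CapSignListLength

/-!
# Gaps / CapBlockTowerEmpty — «CAP-FREE BY BLOCK POWER»: on the Q-asym1-5 road the CAP sign list EMPTIES along the block tower `L₀ⁿ`
# (cell pub-balaban-gaps, seat g1-p3 gen 5, CAP+tail «split ∕ weakening» charge; companion of `CapBlockTransferFloors` (gen 2: floors and
# SIGNS transfer along block sums) and `CapSignListLength` (gen 4: the sharp list `{k ∣ β⁰_∞ ≤ c₀θ^k}`, empty iff `c₀ < β⁰_∞`);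
# v1.1: g1-plan-2 GEN 13 XREAD X-77 PASS — wording remarks R-6 (small block not a printed construction) and R-7 («one-loop» composition) folded)

HONEST FRAMING (cell rule, page 1 of everything): bookkeeping over hypothesis SHAPES of the tree's β sub-cell; NOTHING of Bałaban's is asserted
beyond print; [Balaban1987RG1] Thm 2 is UNPROVED IN PRINT and enters only as the conclusion `B12.Thm2Printed C L`; the small-block rate
constants `β⁰_∞, c₀, θ` are HYPOTHESES (`Beta.RateCertificate.GeomRate`; rows NE4 ∕ G-an2-4 — OPEN; [I] p. 264 «other properties in a separate
paper»); the ONE-LOOP composition hypothesis `hblock : S.β0 k = blockSum n b k` (one-loop coefficients at block size `L₀ⁿ` = block sums of those at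
block size `L₀`) resp. its nearness form `NearRate` is asym1's located question Q-asym1-5 — a BINDER, never asserted (schemes (S1)∕(S2)∕(S3) of
`Beta.RateCertificate` §10); (D4) enters as `EverySlope` ∕ `LimitForm` for the `L₀ⁿ`-construction; NO coefficient of Bałaban's β⁰ is certified
to date at any block size; 0∕6 binders discharged; one finite T⁴; NOT `BetaPertH`, NOT the continuum limit, NOT Clay.  HONEST DEPENDENCY (b2b
cell, verbatim): «continuum YM on T⁴ ⇐ BetaPertH ∧ nine spine estimates (0/9 proved); BetaPertH ⇐ (D1) ∧ (D4) ∧ CAP+tail; G-an2-4 gates asym,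
D1 and NE2/3/4.»

THE POINT ([folklore] sequence algebra).  `GeomRate b β⁰_∞ c₀ θ` at ONE small block size (`0 ≤ θ`) gives for the block sums
`blockSum n b k = Σ_{i<n} b_{nk+i}` the lower envelope `n·β⁰_∞ − c₀·(Σ_{i<n}θ^i)·θ^{nk} ≤ blockSum n b k` (`Beta.RateCertificate.geomRate_blockSum`,
lower half), hence uniformly in `k` (θ ≤ 1) `n·β⁰_∞ − c₀·Σ_{i<n}θ^i`, and (θ < 1) `n·β⁰_∞ − c₀∕(1−θ)`.  So:
§1 envelopes; §2 the TOWER TEST `c₀·Σ_{i<n}θ^i < n·β⁰_∞`: it holds at `n = 1` iff `c₀ < β⁰_∞` (gen 4's empty list), is MONOTONE in `n`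
   (`towerTest_succ`), and holds for every `n ≥ ⌊c₀∕((1−θ)β⁰_∞)⌋₊ + 1` as soon as `0 < β⁰_∞` (`towerTest_of_index_le`) — and `0 < β⁰_∞` is
   NECESSARY for (0.31) on the rate road anyway (`CapTailLimitNecessary.binf_pos_of_thm2Printed_geomRate`, gen 3) and without it the test fails
   at every `n` (`not_towerTest_of_binf_nonpos`); so the CAP-free powers form a FINAL SEGMENT `[N, ∞)`, `1 ≤ N ≤ ⌊c₀∕((1−θ)β⁰_∞)⌋₊ + 1`
   (`exists_towerThreshold`);
§3 the tower test gives a uniform positive floor of ALL block sums with NO sign and NO certified value asked (`blockSums_floor_of_towerTest`),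
   and it is SHARP: if it fails, the rate ALLOWS a nonpositive first block sum (`rate_allows_nonpos_blockSum`, witness `b_i = β⁰_∞ − c₀θ^i`);
   `blockSums_pos_iff`; in gen 4's words the big-block CAP set `{k ∣ n·β⁰_∞ ≤ c₀(Σ_{i<n}θ^i)(θⁿ)^k}` is EMPTY iff the tower test holds
   (`bigBlock_capSet_empty_iff`, `bigBlock_capSet_empty_of_index_le`), and below the threshold the residue is the sign list on exactly that
   set (`beta0_pos_all_of_bigBlock_capSigns`: `CapSignListLength.capSet_exact` applied to the big-block rate) — gen 4's follow-up (iii)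
   «`thm2Printed_pow_of_smallBlockSigns` at the SHARP length» is this statement;
§4 ENDs for the `L₀ⁿ`-construction under Q-asym1-5: `beta0Floor_of_blockTower` (`hblock`), **`thm2Printed_of_blockTower_everySlope`** (rate at
   `L₀` + `0 < β⁰_∞` + `n ≥ ⌊c₀∕((1−θ)β⁰_∞)⌋₊+1` + `hblock` + `EverySlope` + (C) + (U) + forward generation ⟹ `B12.Thm2Printed C L'` — the CAP
   is EMPTY), its sharp-test form, `betaAFH_of_blockTower_everySlope`, the NEARNESS form `thm2Printed_of_blockTowerNear_everySlope`
   (`NearRate (blockSum n b) S.β0 e ϑ`, `e` paid against the floor), and the LIMIT-FORM road `thm2Printed_of_blockTower_limitForm`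
   (`CapTailSigns.thm2Printed_of_signs` with every sign supplied);
§5 reading: print-admissible tower members («L odd > 11», p. 251: `13ⁿ` from `n = 1`, `3ⁿ` from `n = 3`, `5ⁿ` from `n = 2` — the small block
   `L₀ = 3, 5` itself is NOT a printed construction, only its one-loop numbers enter via `hblock`: `tower_printAdmissible`); the tower floor
   `n·β⁰_∞ − c₀∕(1−θ)` IS the large-`L` log-growth currency along the tower (`towerFloor_eq_logGrowth`: `= (β⁰_∞∕log L₀)·log(L₀ⁿ) − c₀∕(1−θ)`,
   cf. `CapTailFloors.thm2Printed_of_logGrowth_everySlope`, `CapFreeLargeL`); numbers (`β⁰_∞ = 1, c₀ = 4, θ = 1∕2`: sharp threshold 8,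
   index bound 9: `towerTest_numbers`).
READING for rows CAP ∕ tail and for the (M)∕CA-1 decision: on the Q-asym1-5 road NO sign computation is needed at ANY block size that is a
high enough power `L₀ⁿ`; the whole input is the TAIL at ONE small block size (`β⁰_∞ > 0`, `c₀`, `θ` — row G-an2-4, uncertified) and `n₀` is
explicit in those constants; END-grade statements were already CAP-free from an eventual floor (`CapTailFloors`), the gain here is THEOREM-2
grade (every `k`).  Nothing here lowers the price of Q-asym1-5 or of (D4) at the big block size.  0 sorry; 0 def; imports tree files only.

CITATION HEADER (tags CONTEXT ONLY).  [I] = T. Bałaban, Commun. Math. Phys. **109** (1987) [Balaban1987RG1]: Thm 2 p. 259 with (0.31); p. 251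
(«L odd > 11»); p. 254 («we may use many other definitions» — a remark); (1.22) p. 264; (2.12)–(2.14) p. 268.
-/

namespace Summit.QuantumFields.BalabanUV.Gaps.CapBlockTowerEmpty

open Literature.MathematicalPhysics.QuantumFieldTheory.Balaban1983to89
open Literature.MathematicalPhysics.QuantumFieldTheory.Balaban1983to89.FlowStep
open Literature.MathematicalPhysics.QuantumFieldTheory.Balaban1983to89.FlowStepRuns
open Literature.MathematicalPhysics.QuantumFieldTheory.Balaban1983to89.DagBinding
open Literature.MathematicalPhysics.QuantumFieldTheory.Balaban1983to89.Beta.RateCertificate (GeomRate NearRate blockSum geomRate_blockSum)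
open Summit.QuantumFields.BalabanUV.Gaps.CapSignsConstRoad (EverySlope thm2Printed_of_beta0Floor_everySlope betaAFH_of_beta0Floor_everySlope)
open Summit.QuantumFields.BalabanUV.Gaps.CapSignListLength (capSet_empty_iff)
open Finset

noncomputable section

/-! ## §1 Block sums under a small-block rate: lower envelopes -/

/-- For `0 ≤ θ ≤ 1` every term `θ^i`, `i < n`, is at least `θ^n`: `n·θ^n ≤ Σ_{i<n} θ^i`. [folklore] -/
theorem card_mul_pow_le_geomSum {θ : ℝ} (hθ0 : 0 ≤ θ) (hθ1 : θ ≤ 1) (n : ℕ) : (n : ℝ) * θ ^ n ≤ ∑ i ∈ range n, θ ^ i :=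
  calc (n : ℝ) * θ ^ n = ∑ _i ∈ range n, θ ^ n := by simp
    _ ≤ ∑ i ∈ range n, θ ^ i := sum_le_sum fun i hi => pow_le_pow_of_le_one hθ0 hθ1 (mem_range.mp hi).le

/-- **Exact lower envelope of the block sums** (lower half of `Beta.RateCertificate.geomRate_blockSum`): `GeomRate b β⁰_∞ c₀ θ` ⟹
`n·β⁰_∞ − c₀·(Σ_{i<n}θ^i)·(θⁿ)^k ≤ blockSum n b k`. [folklore] -/
theorem blockSum_ge_of_geomRate {b : ℕ → ℝ} {binf c₀ θ : ℝ} (hconv : GeomRate b binf c₀ θ) (n k : ℕ) :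
    (n : ℝ) * binf - c₀ * (∑ i ∈ range n, θ ^ i) * (θ ^ n) ^ k ≤ blockSum n b k := by
  have h := (abs_le.mp (geomRate_blockSum hconv n k)).1
  linarith

/-- Uniform-in-`k` envelope (`0 ≤ θ ≤ 1`): `n·β⁰_∞ − c₀·Σ_{i<n}θ^i ≤ blockSum n b k`. [folklore] -/
theorem blockSum_ge_uniform {b : ℕ → ℝ} {binf c₀ θ : ℝ} (hconv : GeomRate b binf c₀ θ) (hθ0 : 0 ≤ θ) (hθ1 : θ ≤ 1)
    (n k : ℕ) : (n : ℝ) * binf - c₀ * ∑ i ∈ range n, θ ^ i ≤ blockSum n b k := by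
  have h := blockSum_ge_of_geomRate hconv n k
  have hS : 0 ≤ c₀ * ∑ i ∈ range n, θ ^ i := mul_nonneg hconv.const_nonneg (sum_nonneg fun i _ => pow_nonneg hθ0 i)
  have hpow : (θ ^ n) ^ k ≤ 1 := pow_le_one₀ (pow_nonneg hθ0 n) (pow_le_one₀ hθ0 hθ1)
  have : c₀ * (∑ i ∈ range n, θ ^ i) * (θ ^ n) ^ k ≤ c₀ * ∑ i ∈ range n, θ ^ i := by
    simpa using mul_le_mul_of_nonneg_left hpow hS
  linarith

/-- **The TOWER FLOOR** (`0 ≤ θ < 1`): `n·β⁰_∞ − c₀∕(1−θ) ≤ blockSum n b k` for all `n, k` — linear growth in `n` up to ONE constant.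
[folklore] -/
theorem blockSum_ge_towerFloor {b : ℕ → ℝ} {binf c₀ θ : ℝ} (hconv : GeomRate b binf c₀ θ) (hθ0 : 0 ≤ θ) (hθ1 : θ < 1)
    (n k : ℕ) : (n : ℝ) * binf - c₀ / (1 - θ) ≤ blockSum n b k := by
  have h := blockSum_ge_uniform hconv hθ0 hθ1.le n k
  have : c₀ * ∑ i ∈ range n, θ ^ i ≤ c₀ / (1 - θ) := by
    have hg : ∑ i ∈ range n, θ ^ i ≤ θ ^ 0 / (1 - θ) := by
      rw [range_eq_Ico]; exact geom_sum_Ico_le_of_lt_one hθ0 hθ1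
    calc c₀ * ∑ i ∈ range n, θ ^ i ≤ c₀ * (θ ^ 0 / (1 - θ)) := mul_le_mul_of_nonneg_left hg hconv.const_nonneg
      _ = c₀ / (1 - θ) := by rw [pow_zero]; ring
  linarith

/-! ## §2 The tower test `c₀·Σ_{i<n}θ^i < n·β⁰_∞`: first member, monotonicity, explicit index -/

/-- At `n = 1` the tower test is gen 4's empty-list condition `c₀ < β⁰_∞` (`CapSignListLength.capSet_empty_iff`). [folklore] -/
theorem towerTest_one_iff {binf c₀ θ : ℝ} : c₀ * ∑ i ∈ range 1, θ ^ i < (1 : ℕ) * binf ↔ c₀ < binf := by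
  simp

/-- The tower test FAILS at `n = 0` (empty block). [folklore] -/
theorem not_towerTest_zero {binf c₀ θ : ℝ} : ¬ c₀ * ∑ i ∈ range 0, θ ^ i < (0 : ℕ) * binf := by
  simp

/-- **MONOTONICITY** (`0 ≤ c₀`, `0 ≤ θ ≤ 1`): the tower test at `n` implies it at `n + 1`.  (If `c₀θⁿ ≤ β⁰_∞` add it; otherwise
`c₀·Σ_{i<n}θ^i ≥ n·c₀θⁿ ≥ n·β⁰_∞` contradicts the test at `n`.)  So the test holds exactly from its least solution on. [folklore] -/
theorem towerTest_succ {binf c₀ θ : ℝ} (hc₀ : 0 ≤ c₀) (hθ0 : 0 ≤ θ) (hθ1 : θ ≤ 1) {n : ℕ}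
    (h : c₀ * ∑ i ∈ range n, θ ^ i < (n : ℝ) * binf) : c₀ * ∑ i ∈ range (n + 1), θ ^ i < ((n + 1 : ℕ) : ℝ) * binf := by
  rw [sum_range_succ, mul_add, Nat.cast_succ, add_mul, one_mul]
  rcases le_or_gt (c₀ * θ ^ n) binf with hle | hgt
  · linarith
  · exfalso
    have h1 : (n : ℝ) * binf ≤ (n : ℝ) * (c₀ * θ ^ n) := mul_le_mul_of_nonneg_left hgt.le (Nat.cast_nonneg n)
    have h2 : (n : ℝ) * (c₀ * θ ^ n) ≤ c₀ * ∑ i ∈ range n, θ ^ i := by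
      calc (n : ℝ) * (c₀ * θ ^ n) = c₀ * ((n : ℝ) * θ ^ n) := by ring
        _ ≤ c₀ * ∑ i ∈ range n, θ ^ i := mul_le_mul_of_nonneg_left (card_mul_pow_le_geomSum hθ0 hθ1 n) hc₀
    linarith

/-- Upward closure: the tower test at `m` implies it at every `n ≥ m`. [folklore] -/
theorem towerTest_of_le {binf c₀ θ : ℝ} (hc₀ : 0 ≤ c₀) (hθ0 : 0 ≤ θ) (hθ1 : θ ≤ 1) {m n : ℕ} (hmn : m ≤ n)
    (h : c₀ * ∑ i ∈ range m, θ ^ i < (m : ℝ) * binf) : c₀ * ∑ i ∈ range n, θ ^ i < (n : ℝ) * binf := by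
  induction n, hmn using Nat.le_induction with
  | base => exact h
  | succ n _ ih => exact towerTest_succ hc₀ hθ0 hθ1 ih

/-- **EXPLICIT INDEX**: `0 < β⁰_∞`, `0 ≤ c₀`, `0 ≤ θ < 1`, `n ≥ ⌊c₀∕((1−θ)β⁰_∞)⌋₊ + 1` ⟹ `c₀∕(1−θ) < n·β⁰_∞`, hence the tower test
(`c₀·Σ_{i<n}θ^i ≤ c₀∕(1−θ)`). [folklore] -/
theorem inv_lt_of_index_le {binf c₀ θ : ℝ} (hbinf : 0 < binf) (hθ1 : θ < 1) {n : ℕ}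
    (hn : ⌊c₀ / ((1 - θ) * binf)⌋₊ + 1 ≤ n) : c₀ / (1 - θ) < (n : ℝ) * binf := by
  have h1 : c₀ / ((1 - θ) * binf) < (n : ℝ) := by
    calc c₀ / ((1 - θ) * binf) < (⌊c₀ / ((1 - θ) * binf)⌋₊ : ℝ) + 1 := Nat.lt_floor_add_one _
      _ = ((⌊c₀ / ((1 - θ) * binf)⌋₊ + 1 : ℕ) : ℝ) := by push_cast; ring
      _ ≤ (n : ℝ) := by exact_mod_cast hn
  have h1θ : 0 < 1 - θ := sub_pos.mpr hθ1
  rw [div_lt_iff₀ (mul_pos h1θ hbinf)] at h1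
  rw [div_lt_iff₀ h1θ]
  linarith

/-- The tower test from the explicit index. [folklore] -/
theorem towerTest_of_index_le {binf c₀ θ : ℝ} (hbinf : 0 < binf) (hc₀ : 0 ≤ c₀) (hθ0 : 0 ≤ θ) (hθ1 : θ < 1) {n : ℕ}
    (hn : ⌊c₀ / ((1 - θ) * binf)⌋₊ + 1 ≤ n) : c₀ * ∑ i ∈ range n, θ ^ i < (n : ℝ) * binf := by
  have h1 := inv_lt_of_index_le hbinf hθ1 hn
  have h2 : c₀ * ∑ i ∈ range n, θ ^ i ≤ c₀ / (1 - θ) := by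
    have hg : ∑ i ∈ range n, θ ^ i ≤ θ ^ 0 / (1 - θ) := by
      rw [range_eq_Ico]; exact geom_sum_Ico_le_of_lt_one hθ0 hθ1
    calc c₀ * ∑ i ∈ range n, θ ^ i ≤ c₀ * (θ ^ 0 / (1 - θ)) := mul_le_mul_of_nonneg_left hg hc₀
      _ = c₀ / (1 - θ) := by rw [pow_zero]; ring
  linarith

/-- Conversely a positive limit is all the explicit index needs: with `β⁰_∞ ≤ 0` (and `0 ≤ c₀`, `0 ≤ θ`) the tower test fails at EVERY `n`.
[folklore] -/
theorem not_towerTest_of_binf_nonpos {binf c₀ θ : ℝ} (hbinf : binf ≤ 0) (hc₀ : 0 ≤ c₀) (hθ0 : 0 ≤ θ) (n : ℕ) :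
    ¬ c₀ * ∑ i ∈ range n, θ ^ i < (n : ℝ) * binf := by
  have h1 : 0 ≤ c₀ * ∑ i ∈ range n, θ ^ i := mul_nonneg hc₀ (sum_nonneg fun i _ => pow_nonneg hθ0 i)
  have h2 : (n : ℝ) * binf ≤ 0 := mul_nonpos_of_nonneg_of_nonpos (Nat.cast_nonneg n) hbinf
  exact fun h => by linarith

/-- **THE CAP-FREE POWERS FORM A FINAL SEGMENT `[N, ∞)`** (`0 < β⁰_∞`, `0 ≤ c₀`, `0 ≤ θ < 1`): there is a least power `N` with
`1 ≤ N ≤ ⌊c₀∕((1−θ)β⁰_∞)⌋₊ + 1` such that the tower test holds at `n` iff `N ≤ n` (false at `0`, monotone, true at the explicit index);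
`N = 1` iff `c₀ < β⁰_∞` (`towerTest_one_iff`).  `N` is a function of the (uncertified) tail constants only. [folklore] -/
theorem exists_towerThreshold {binf c₀ θ : ℝ} (hbinf : 0 < binf) (hc₀ : 0 ≤ c₀) (hθ0 : 0 ≤ θ) (hθ1 : θ < 1) :
    ∃ N : ℕ, 1 ≤ N ∧ N ≤ ⌊c₀ / ((1 - θ) * binf)⌋₊ + 1 ∧
      ∀ n : ℕ, c₀ * ∑ i ∈ range n, θ ^ i < (n : ℝ) * binf ↔ N ≤ n := by
  classical
  have hex : ∃ n : ℕ, c₀ * ∑ i ∈ range n, θ ^ i < (n : ℝ) * binf :=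
    ⟨_, towerTest_of_index_le hbinf hc₀ hθ0 hθ1 le_rfl⟩
  refine ⟨Nat.find hex, ?_, Nat.find_min' hex (towerTest_of_index_le hbinf hc₀ hθ0 hθ1 le_rfl), fun n => ⟨fun h => ?_, fun h => ?_⟩⟩
  · rw [Nat.one_le_iff_ne_zero]
    intro h0
    have h := Nat.find_spec hex
    rw [h0] at h
    exact not_towerTest_zero h
  · exact Nat.find_min' hex h
  · exact towerTest_of_le hc₀ hθ0 hθ1.le h (Nat.find_spec hex)

/-! ## §3 All block sums positive: sufficiency of the tower test and its SHARPNESS -/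

/-- **SUFFICIENCY**: rate (`0 ≤ θ ≤ 1`) + the tower test ⟹ the uniform positive floor `n·β⁰_∞ − c₀·Σ_{i<n}θ^i` of ALL block sums — no sign
of any `b_j`, no certified value. [folklore] -/
theorem blockSums_floor_of_towerTest {b : ℕ → ℝ} {binf c₀ θ : ℝ} (hconv : GeomRate b binf c₀ θ) (hθ0 : 0 ≤ θ) (hθ1 : θ ≤ 1)
    {n : ℕ} (hT : c₀ * ∑ i ∈ range n, θ ^ i < (n : ℝ) * binf) : ∃ f : ℝ, 0 < f ∧ ∀ k, f ≤ blockSum n b k :=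
  ⟨(n : ℝ) * binf - c₀ * ∑ i ∈ range n, θ ^ i, sub_pos.mpr hT, blockSum_ge_uniform hconv hθ0 hθ1 n⟩

/-- All block sums are positive under the tower test. [folklore] -/
theorem blockSums_pos_of_towerTest {b : ℕ → ℝ} {binf c₀ θ : ℝ} (hconv : GeomRate b binf c₀ θ) (hθ0 : 0 ≤ θ) (hθ1 : θ ≤ 1)
    {n : ℕ} (hT : c₀ * ∑ i ∈ range n, θ ^ i < (n : ℝ) * binf) : ∀ k, 0 < blockSum n b k := fun k => by
  obtain ⟨f, hf, hF⟩ := blockSums_floor_of_towerTest hconv hθ0 hθ1 hT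
  exact hf.trans_le (hF k)

/-- **FROM THE EXPLICIT INDEX**: rate (`0 ≤ θ < 1`) + `0 < β⁰_∞` + `n ≥ ⌊c₀∕((1−θ)β⁰_∞)⌋₊ + 1` ⟹ the tower floor `n·β⁰_∞ − c₀∕(1−θ)` is
positive and below every block sum. [folklore] -/
theorem blockSums_towerFloor_of_index_le {b : ℕ → ℝ} {binf c₀ θ : ℝ} (hconv : GeomRate b binf c₀ θ) (hbinf : 0 < binf)
    (hθ0 : 0 ≤ θ) (hθ1 : θ < 1) {n : ℕ} (hn : ⌊c₀ / ((1 - θ) * binf)⌋₊ + 1 ≤ n) :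
    0 < (n : ℝ) * binf - c₀ / (1 - θ) ∧ ∀ k, (n : ℝ) * binf - c₀ / (1 - θ) ≤ blockSum n b k :=
  ⟨sub_pos.mpr (inv_lt_of_index_le hbinf hθ1 hn), blockSum_ge_towerFloor hconv hθ0 hθ1 n⟩

/-- **SHARPNESS (the witness)**: if the tower test FAILS (`n·β⁰_∞ ≤ c₀·Σ_{i<n}θ^i`), the rate ALLOWS a nonpositive FIRST block sum: the
sequence `b_i := β⁰_∞ − c₀θ^i` satisfies `GeomRate b β⁰_∞ c₀ θ` (`0 ≤ c₀`, `0 ≤ θ`) and `blockSum n b 0 = n·β⁰_∞ − c₀·Σ_{i<n}θ^i ≤ 0`.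
[folklore] -/
theorem rate_allows_nonpos_blockSum {binf c₀ θ : ℝ} (hc₀ : 0 ≤ c₀) (hθ0 : 0 ≤ θ) {n : ℕ}
    (h : (n : ℝ) * binf ≤ c₀ * ∑ i ∈ range n, θ ^ i) :
    ∃ b : ℕ → ℝ, GeomRate b binf c₀ θ ∧ blockSum n b 0 ≤ 0 := by
  refine ⟨fun i => binf - c₀ * θ ^ i, fun i => ?_, ?_⟩
  · show |binf - c₀ * θ ^ i - binf| ≤ c₀ * θ ^ i
    rw [show binf - c₀ * θ ^ i - binf = -(c₀ * θ ^ i) by ring, abs_neg, abs_of_nonneg (mul_nonneg hc₀ (pow_nonneg hθ0 i))]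
  · have hbs : blockSum n (fun i => binf - c₀ * θ ^ i) 0 = (n : ℝ) * binf - c₀ * ∑ i ∈ range n, θ ^ i := by
      simp only [blockSum, mul_zero, zero_add, sum_sub_distrib, sum_const, card_range, nsmul_eq_mul, mul_sum]
    rw [hbs]
    linarith

/-- **THE EXACT STATEMENT**: for `0 ≤ c₀`, `0 ≤ θ ≤ 1`: «every sequence with `GeomRate b β⁰_∞ c₀ θ` has ALL block sums at power `n`
positive» ⟺ the tower test `c₀·Σ_{i<n}θ^i < n·β⁰_∞`. [folklore] -/
theorem blockSums_pos_iff {binf c₀ θ : ℝ} (hc₀ : 0 ≤ c₀) (hθ0 : 0 ≤ θ) (hθ1 : θ ≤ 1) (n : ℕ) :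
    (∀ b : ℕ → ℝ, GeomRate b binf c₀ θ → ∀ k, 0 < blockSum n b k) ↔ c₀ * ∑ i ∈ range n, θ ^ i < (n : ℝ) * binf := by
  refine ⟨fun h => lt_of_not_ge fun hle => ?_, fun hT b hconv => blockSums_pos_of_towerTest hconv hθ0 hθ1 hT⟩
  obtain ⟨b, hb, h0⟩ := rate_allows_nonpos_blockSum hc₀ hθ0 hle
  exact absurd (h b hb 0) (not_lt.mpr h0)

/-- **In gen 4's words**: the block sums carry the big-block rate `GeomRate (blockSum n b) (n·β⁰_∞) (c₀Σ_{i<n}θ^i) (θⁿ)` (`geomRate_blockSum`),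
whose CAP set `{k ∣ n·β⁰_∞ ≤ c₀(Σ_{i<n}θ^i)·(θⁿ)^k}` (`CapSignListLength.capSet_exact`) is EMPTY iff the tower test holds
(`CapSignListLength.capSet_empty_iff` at the big-block constants). [folklore] -/
theorem bigBlock_capSet_empty_iff {binf c₀ θ : ℝ} (hc₀ : 0 ≤ c₀) (hθ0 : 0 ≤ θ) (hθ1 : θ ≤ 1) (n : ℕ) :
    {k : ℕ | (n : ℝ) * binf ≤ (c₀ * ∑ i ∈ range n, θ ^ i) * (θ ^ n) ^ k} = ∅ ↔
      c₀ * ∑ i ∈ range n, θ ^ i < (n : ℝ) * binf :=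
  capSet_empty_iff (mul_nonneg hc₀ (sum_nonneg fun i _ => pow_nonneg hθ0 i)) (pow_nonneg hθ0 n) (pow_le_one₀ hθ0 hθ1)

/-- **THE BIG-BLOCK CAP SET IS EMPTY FROM THE EXPLICIT INDEX ON** (`0 < β⁰_∞`, `0 ≤ c₀`, `0 ≤ θ < 1`, `n ≥ ⌊c₀∕((1−θ)β⁰_∞)⌋₊ + 1`).
[folklore] -/
theorem bigBlock_capSet_empty_of_index_le {binf c₀ θ : ℝ} (hbinf : 0 < binf) (hc₀ : 0 ≤ c₀) (hθ0 : 0 ≤ θ) (hθ1 : θ < 1)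
    {n : ℕ} (hn : ⌊c₀ / ((1 - θ) * binf)⌋₊ + 1 ≤ n) :
    {k : ℕ | (n : ℝ) * binf ≤ (c₀ * ∑ i ∈ range n, θ ^ i) * (θ ^ n) ^ k} = ∅ :=
  (bigBlock_capSet_empty_iff hc₀ hθ0 hθ1.le n).mpr (towerTest_of_index_le hbinf hc₀ hθ0 hθ1 hn)

/-! ## §4 ENDs for the `L₀ⁿ`-construction under Q-asym1-5 — the CAP is EMPTY -/

variable {β : HBeta}

/-- **Equality form (the ONE-LOOP composition hypothesis Q-asym1-5 as `hblock`)**: the large-block one-loop coefficients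
`S.β0 k = blockSum n b k` inherit the tower floor:
rate at the small block (`0 ≤ θ < 1`), `0 < β⁰_∞`, `n ≥ ⌊c₀∕((1−θ)β⁰_∞)⌋₊ + 1` ⟹ `0 < n·β⁰_∞ − c₀∕(1−θ) ≤ β⁰_{k+1}` for EVERY `k`.
[cite: Balaban1987RG1, (1.22) p.264] -/
theorem beta0Floor_of_blockTower (S : B12Beta.OneLoopSplit β) {b : ℕ → ℝ} {n : ℕ} (hblock : ∀ k, S.β0 k = blockSum n b k)
    {binf c₀ θ : ℝ} (hconv : GeomRate b binf c₀ θ) (hbinf : 0 < binf) (hθ0 : 0 ≤ θ) (hθ1 : θ < 1)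
    (hn : ⌊c₀ / ((1 - θ) * binf)⌋₊ + 1 ≤ n) :
    0 < (n : ℝ) * binf - c₀ / (1 - θ) ∧ ∀ k, (n : ℝ) * binf - c₀ / (1 - θ) ≤ S.β0 k := by
  obtain ⟨hpos, hF⟩ := blockSums_towerFloor_of_index_le hconv hbinf hθ0 hθ1 hn
  exact ⟨hpos, fun k => (hblock k).symm ▸ hF k⟩

/-- **[Balaban1987RG1] THEOREM 2 AS PRINTED FOR THE `L₀ⁿ`-CONSTRUCTION WITH THE CAP EMPTY, every-slope road**: the DAG `C` of the
block-size-`L₀ⁿ` construction (forward generation), its split `S`; the SMALL-block rate `GeomRate b β⁰_∞ c₀ θ` (`0 ≤ θ < 1`) with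
`0 < β⁰_∞`; the power `n ≥ ⌊c₀∕((1−θ)β⁰_∞)⌋₊ + 1`; the ONE-LOOP composition hypothesis `hblock` (Q-asym1-5 — composition at one-loop order only —, a
binder); `EverySlope S γc` for this
construction ((D4) currency), (C), (U) ⟹ `B12.Thm2Printed C L'` for every log-unit `L' > 1` — NO sign of any coefficient, NO certified value
(`CapSignsConstRoad.thm2Printed_of_beta0Floor_everySlope` on the tower floor).  Inputs BY NAME that no printed source supplies: the rate
constants at `L₀` (row G-an2-4), Q-asym1-5, the every-slope residue (row (D4)), (C). [cite: Balaban1987RG1, Thm 2 p.259 with (0.31) and (1.22) p.264] -/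
theorem thm2Printed_of_blockTower_everySlope {C : B12.Construction} (hgen : ForwardGenerated C β) {L' : ℝ} (hL : 1 < L')
    (S : B12Beta.OneLoopSplit β) {b : ℕ → ℝ} {n : ℕ} (hblock : ∀ k, S.β0 k = blockSum n b k) {binf c₀ θ γc β' : ℝ}
    (hconv : GeomRate b binf c₀ θ) (hbinf : 0 < binf) (hθ0 : 0 ≤ θ) (hθ1 : θ < 1) (hn : ⌊c₀ / ((1 - θ) * binf)⌋₊ + 1 ≤ n)
    (hrem : EverySlope S γc) (hcont : BetaContH γc β) (hup : BetaUpperH β' γc β) : B12.Thm2Printed C L' := by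
  obtain ⟨hpos, hF⟩ := beta0Floor_of_blockTower S hblock hconv hbinf hθ0 hθ1 hn
  exact thm2Printed_of_beta0Floor_everySlope hgen hL S hpos hF hrem hcont hup

/-- The same END at the SHARP tower test `c₀·Σ_{i<n}θ^i < n·β⁰_∞` (`0 ≤ θ ≤ 1`; floor `n·β⁰_∞ − c₀Σ_{i<n}θ^i`).
[cite: Balaban1987RG1, Thm 2 p.259 with (0.31) and (1.22) p.264] -/
theorem thm2Printed_of_blockTower_everySlope_sharp {C : B12.Construction} (hgen : ForwardGenerated C β) {L' : ℝ} (hL : 1 < L')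
    (S : B12Beta.OneLoopSplit β) {b : ℕ → ℝ} {n : ℕ} (hblock : ∀ k, S.β0 k = blockSum n b k) {binf c₀ θ γc β' : ℝ}
    (hconv : GeomRate b binf c₀ θ) (hθ0 : 0 ≤ θ) (hθ1 : θ ≤ 1) (hT : c₀ * ∑ i ∈ range n, θ ^ i < (n : ℝ) * binf)
    (hrem : EverySlope S γc) (hcont : BetaContH γc β) (hup : BetaUpperH β' γc β) : B12.Thm2Printed C L' := by
  obtain ⟨f, hf, hF⟩ := blockSums_floor_of_towerTest hconv hθ0 hθ1 hT
  exact thm2Printed_of_beta0Floor_everySlope hgen hL S hf (fun k => (hblock k).symm ▸ hF k) hrem hcont hup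

/-- `BetaAFH β` (discrete asymptotic freedom of the `L₀ⁿ`-construction's β) from the small-block rate, `0 < β⁰_∞`, the explicit index, `hblock`
and `EverySlope` — CAP empty. [folklore] -/
theorem betaAFH_of_blockTower_everySlope (S : B12Beta.OneLoopSplit β) {b : ℕ → ℝ} {n : ℕ}
    (hblock : ∀ k, S.β0 k = blockSum n b k) {binf c₀ θ γc : ℝ} (hconv : GeomRate b binf c₀ θ) (hbinf : 0 < binf)
    (hθ0 : 0 ≤ θ) (hθ1 : θ < 1) (hn : ⌊c₀ / ((1 - θ) * binf)⌋₊ + 1 ≤ n) (hrem : EverySlope S γc) : BetaAFH β := by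
  obtain ⟨hpos, hF⟩ := beta0Floor_of_blockTower S hblock hconv hbinf hθ0 hθ1 hn
  exact betaAFH_of_beta0Floor_everySlope S hpos hF hrem

/-- **The NEARNESS form** (scheme (S3), the one-loop composition question Q-asym1-5 in inequality currency): `NearRate (blockSum n b) S.β0 e ϑ`
with `0 ≤ ϑ ≤ 1`, the
small-block rate (`0 ≤ θ < 1`), and the transfer constant PAID AGAINST THE TOWER FLOOR `e < n·β⁰_∞ − c₀∕(1−θ)`; `EverySlope`, (C), (U),
forward generation ⟹ `B12.Thm2Printed C L'` (floor `n·β⁰_∞ − c₀∕(1−θ) − e`).  Honest: if the nearness constant `e = e(n)` grows linearly in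
`n`, this is a genuine condition. [cite: Balaban1987RG1, Thm 2 p.259 with (0.31) and (1.22) p.264] -/
theorem thm2Printed_of_blockTowerNear_everySlope {C : B12.Construction} (hgen : ForwardGenerated C β) {L' : ℝ} (hL : 1 < L')
    (S : B12Beta.OneLoopSplit β) {b : ℕ → ℝ} {n : ℕ} {e ϑ : ℝ} (hnear : NearRate (blockSum n b) S.β0 e ϑ) (hϑ0 : 0 ≤ ϑ)
    (hϑ1 : ϑ ≤ 1) {binf c₀ θ γc β' : ℝ} (hconv : GeomRate b binf c₀ θ) (hθ0 : 0 ≤ θ) (hθ1 : θ < 1)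
    (he : e < (n : ℝ) * binf - c₀ / (1 - θ)) (hrem : EverySlope S γc) (hcont : BetaContH γc β) (hup : BetaUpperH β' γc β) :
    B12.Thm2Printed C L' := by
  have hF : ∀ k, (n : ℝ) * binf - c₀ / (1 - θ) - e ≤ S.β0 k := fun k => by
    have h1 := hnear.sub_le hϑ0 hϑ1 k
    have h2 := blockSum_ge_towerFloor hconv hθ0 hθ1 n k
    linarith
  exact thm2Printed_of_beta0Floor_everySlope hgen hL S (sub_pos.mpr he) hF hrem hcont hup

/-- **LIMIT-FORM ROAD** (`Beta.Assembly.LimitForm` of the `L₀ⁿ`-construction, i.e. rate + (AF-1) + (C) + (U) at the big block, whatever its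
threshold scale `k₀`): if its one-loop coefficients are block sums (`hblock`, one-loop composition) of a small-block sequence with `GeomRate b β⁰_∞ c₀ θ`
(`0 ≤ θ < 1`, `0 < β⁰_∞`) and `n ≥ ⌊c₀∕((1−θ)β⁰_∞)⌋₊ + 1`, then EVERY sign the CAP could ask is supplied, so `B12.Thm2Printed C L'`
(`CapTailSigns.thm2Printed_of_signs`). [cite: Balaban1987RG1, Thm 2 p.259 with (0.31) and (1.22) p.264] -/
theorem thm2Printed_of_blockTower_limitForm (D : Beta.Assembly.LimitForm β) {C : B12.Construction} (hgen : ForwardGenerated C β)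
    {L' : ℝ} (hL : 1 < L') {b : ℕ → ℝ} {n : ℕ} (hblock : ∀ k, D.S.β0 k = blockSum n b k) {binf c₀ θ : ℝ}
    (hconv : GeomRate b binf c₀ θ) (hbinf : 0 < binf) (hθ0 : 0 ≤ θ) (hθ1 : θ < 1) (hn : ⌊c₀ / ((1 - θ) * binf)⌋₊ + 1 ≤ n) :
    B12.Thm2Printed C L' := by
  obtain ⟨hpos, hF⟩ := beta0Floor_of_blockTower D.S hblock hconv hbinf hθ0 hθ1 hn
  exact CapTailSigns.thm2Printed_of_signs D hgen hL fun k _ => hpos.trans_le (hF k)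

/-- **BELOW THE THRESHOLD the residue is gen 4's list at the big block**: `hblock`, the small-block rate (`0 ≤ θ`, `0 < β⁰_∞`, `0 < n`)
and certified SIGNS of the block sums on the big-block CAP set `{k ∣ n·β⁰_∞ ≤ c₀(Σ_{i<n}θ^i)(θⁿ)^k}` ⟹ all `β⁰_{k+1} > 0`
(`CapSignListLength.capSet_exact` for the big-block rate `geomRate_blockSum`); with `EverySlope`, (C), (U) the (0.31) END follows as in
`CapBlockTransferFloors`.  For `n` passing the tower test the set is empty (§3). [cite: Balaban1987RG1, (1.22) p.264] -/
theorem beta0_pos_all_of_bigBlock_capSigns (S : B12Beta.OneLoopSplit β) {b : ℕ → ℝ} {n : ℕ} (hn : 0 < n)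
    (hblock : ∀ k, S.β0 k = blockSum n b k) {binf c₀ θ : ℝ} (hconv : GeomRate b binf c₀ θ) (hbinf : 0 < binf) (hθ0 : 0 ≤ θ)
    (hsign : ∀ k, (n : ℝ) * binf ≤ (c₀ * ∑ i ∈ range n, θ ^ i) * (θ ^ n) ^ k → 0 < blockSum n b k) :
    ∀ k, 0 < S.β0 k := fun k => by
  have hI := (CapSignListLength.capSet_exact (mul_pos (by exact_mod_cast hn) hbinf)
    (mul_nonneg hconv.const_nonneg (sum_nonneg fun i _ => pow_nonneg hθ0 i)) (pow_nonneg hθ0 n)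
    {k : ℕ | (n : ℝ) * binf ≤ (c₀ * ∑ i ∈ range n, θ ^ i) * (θ ^ n) ^ k}).mpr subset_rfl
  rw [hblock]
  exact hI (blockSum n b) (geomRate_blockSum hconv n) (fun k hk => hsign k hk) k

/-! ## §5 Reading: print-admissible tower members; the tower floor as log-growth; numbers -/

/-- PRINT-ADMISSIBLE MEMBERS OF TOWERS ([I] p. 251 «L odd > 11»): the tower of the smallest printed block size `13` is admissible from `n = 1` on;
the BIG blocks `3ⁿ` (`n ≥ 3`) and `5ⁿ` (`n ≥ 2`) are odd and `> 11`; no power of `2` is.  Honest clause (g1-plan-2 R-6): the SMALL block `L₀ = 3` or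
`5` is NOT itself a print-admissible construction — only its one-loop coefficients (perturbative numbers, defined at every `L`) enter, through the
one-loop composition hypothesis `hblock`; nobody should read `L₀ = 3` as a construction. (Cf. `CapNegSocketOnePoint.pow_blockSizes`.)
[cite: Balaban1987RG1, p.251] -/
theorem tower_printAdmissible :
    (∀ n : ℕ, 1 ≤ n → Odd (13 ^ n) ∧ 11 < 13 ^ n) ∧ (∀ n : ℕ, 3 ≤ n → Odd (3 ^ n) ∧ 11 < 3 ^ n) ∧
      (∀ n : ℕ, 2 ≤ n → Odd (5 ^ n) ∧ 11 < 5 ^ n) ∧ ∀ n : ℕ, n ≠ 0 → ¬ Odd (2 ^ n) := by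
  refine ⟨fun n hn => ⟨Odd.pow (by decide), ?_⟩, fun n hn => ⟨Odd.pow (by decide), ?_⟩,
    fun n hn => ⟨Odd.pow (by decide), ?_⟩, fun n hn h => ?_⟩
  · calc 11 < 13 ^ 1 := by norm_num
      _ ≤ 13 ^ n := Nat.pow_le_pow_right (by norm_num) hn
  · calc 11 < 3 ^ 3 := by norm_num
      _ ≤ 3 ^ n := Nat.pow_le_pow_right (by norm_num) hn
  · calc 11 < 5 ^ 2 := by norm_num
      _ ≤ 5 ^ n := Nat.pow_le_pow_right (by norm_num) hn
  · exact (Nat.not_even_iff_odd.mpr h) ((Nat.even_pow' hn).mpr (by decide))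

/-- **The tower floor IS the large-`L` log-growth currency along the tower**: for `1 < L₀`,
`n·β⁰_∞ − A = (β⁰_∞ ∕ log L₀)·log (L₀ⁿ) − A` — the shape `c·log L − A ≤ β⁰_{k+1}(L)` of `Beta.LargeL.LogGrowthLower` ∕
`CapTailFloors.thm2Printed_of_logGrowth_everySlope` ∕ `CapFreeLargeL`, restricted to `L ∈ {L₀ⁿ}`, with slope `β⁰_∞∕log L₀` and constant
`A = c₀∕(1−θ)`. [folklore] -/
theorem towerFloor_eq_logGrowth {L₀ : ℝ} (hL₀ : 1 < L₀) (binf A : ℝ) (n : ℕ) :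
    (n : ℝ) * binf - A = binf / Real.log L₀ * Real.log (L₀ ^ n) - A := by
  have hlog : Real.log L₀ ≠ 0 := (Real.log_pos hL₀).ne'
  rw [Real.log_pow]
  field_simp

/-- NUMBERS (shape only, no coefficient of Bałaban's): with `β⁰_∞ = 1`, `c₀ = 4`, `θ = 1∕2` the SHARP threshold is `n = 8` (the tower test
fails at `7`: `4·(2 − 2⁻⁶) = 7.9375 ≥ 7`, holds at `8`: `4·(2 − 2⁻⁷) = 7.96875 < 8`) while the explicit index is `⌊4∕((1−1∕2)·1)⌋₊ + 1 = 9`;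
at `n = 1` the list is NOT empty (`c₀ = 4 ≥ 1 = β⁰_∞`). [folklore] -/
theorem towerTest_numbers :
    ¬ (4 : ℝ) * ∑ i ∈ range 7, (1 / 2 : ℝ) ^ i < (7 : ℕ) * (1 : ℝ) ∧
      (4 : ℝ) * ∑ i ∈ range 8, (1 / 2 : ℝ) ^ i < (8 : ℕ) * (1 : ℝ) ∧
      ⌊(4 : ℝ) / ((1 - 1 / 2) * 1)⌋₊ + 1 = 9 ∧ ¬ (4 : ℝ) < 1 := by
  refine ⟨?_, ?_, ?_, by norm_num⟩
  · simp only [sum_range_succ, sum_range_zero]; norm_num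
  · simp only [sum_range_succ, sum_range_zero]; norm_num
  · have : (4 : ℝ) / ((1 - 1 / 2) * 1) = (8 : ℕ) := by norm_num
    rw [this, Nat.floor_natCast]

end

end Summit.QuantumFields.BalabanUV.Gaps.CapBlockTowerEmpty
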